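import Literature.InformationTheory.StateDiscrimination.MultiparameterQuantumCramerRaoBound
import Literature.InformationTheory.StateDiscrimination.QuantumFisherInformationProperties
import HarnessLib

/-!
# The quantum Fisher matrix of a multiparameter unitary family versus the covariance matrix of its generators:
# `F_Q[ρ, n·Ĥ] = nᵀ𝐅_Qn`, `𝐅_Q = 4𝚪` (pure states), `𝐅_Q ≤ 4𝚪`, concavity and the rank-one upper bound of `𝚪`,
# additivity under `⊗`, and the weak (inverse-free) Cramér–Rao bounds
# (Gessner–Pezzè–Smerzi 2018, main text Eqs. «(weak QCRB)», «𝐅_Q ≤ 4𝚪», Supplement § 1.2)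

Hodge foundations lane (`lit-hodgefound`, prover p24 gen 80; quantum-information series).  THEOREMS ONLY: no
definition, no named fact, net debt 0.  Vocabulary of `QuantumFisherInformationMatrix.lean` /
`MultiparameterQuantumCramerRaoBound.lean` (p24 g80-#1/#2), specialised to the UNITARY multiparameter family
`ρ(θ) = e^{−iĤ·θ} ρ e^{iĤ·θ}` with Hermitian generators `H k` (`k : ι`): derivative data
`∂_kρ = i(ρH_k − H_kρ)` (`Complex.I • (ρ * H k - H k * ρ)`, as in the g79 one-parameter file
`QuantumFisherInformationVarianceBound.lean`), Hermitian SLDs `S k` (`S_kρ + ρS_k = ∂_kρ`), the QFIM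
`hF : F k l = 2 Re Tr(S_k ∂_lρ)`, the generators' COVARIANCE MATRIX
`hΓ : Γ k l = ½ Re Tr(ρ(H_kH_l + H_lH_k)) − Re Tr(ρH_k) Re Tr(ρH_l)` and second-moment matrix
`Γ̃ k l = ½ Re Tr(ρ(H_kH_l + H_lH_k))`, all REAL `ι × ι` matrices; `A ≤ B` is `(B − A).PosSemidef`.

## Source, VERBATIM

M. Gessner, L. Pezzè, A. Smerzi, *Sensitivity bounds for multiparameter quantum metrology*, Phys. Rev. Lett. 121
(2018) 130503 [GessnerPezzeSmerzi2018], held `paper:arxiv-1806.05665` (main text p0003, p0005; Supplementary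
Material § 1.2 «Properties of the quantum Fisher and covariance matrices», p0009–p0010).
* Main text (p0003): «Any linear combination of the `M` parameters, `n·θ = Σ_k n_kθ_k`, is estimated with variance
  `Δ²(Σ_k n_kθ_est,k) = Σ_kl n_kn_l Cov(θ_est,k, θ_est,l) = nᵀΣn`. The matrix `Σ` fulfills the chain of inequalities
  `Σ ≥ 𝐅⁻¹/μ ≥ 𝐅_Q⁻¹/μ` … `(𝐅_Q[ρ])_kl = Tr[ρ L_kL_l]` (sic; the symmetrised form in the Supplement), where
  `dρ/dθ_k = (L_kρ + ρL_k)/2` … `𝐅` and `𝐅_Q` are positive semi-definite matrices and the chain of inequalities is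
  defined only if `𝐅` and `𝐅_Q` are invertible.»  (p0005): «We first derive a weak form of the multiparameter CRB and
  QCRB, `nᵀΣn ≥ 1/(μ nᵀ𝐅n) ≥ 1/(μ nᵀ𝐅_Qn)`, respectively, where we chose the normalization `|n|² = 1`. The
  inequalities can be derived without assuming the existence of the inverse of `𝐅` and `𝐅_Q` [Supp]. … Since
  `nᵀ𝐅⁻¹n ≥ (nᵀ𝐅n)⁻¹` holds for all `n` and all matrices `𝐅`, whenever `𝐅⁻¹` exists, the chain of inequalities (weak)
  is weaker than (matrix). … The state-dependent bound `𝐅_Q[ρ,Ĥ] ≤ 4𝚪[ρ,Ĥ]` holds for arbitrary quantum states `ρ`,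
  where `𝚪[ρ,Ĥ]` is the full covariance matrix.»
* Supplement § 1.2 (p0009): «we can rewrite the phase imprint transformation as `exp(−iĤ·θ) = exp(−iθ₀ Ĥ·n)` …
  The quantum Fisher information `F_Q[ρ, Ĥ·n]` is related to the quantum Fisher matrix by
  `F_Q[ρ, Ĥ·n] = nᵀ𝐅_Q[ρ,Ĥ]n`. … This implies that the quantum Fisher information matrix shares mathematical
  properties of the single-parameter quantum Fisher information.»  § 1.2.1: «the quantum Fisher matrix is convex
  too: `𝐅_Q[Σ_γ p_γρ_γ, Ĥ] ≤ Σ_γ p_γ𝐅_Q[ρ_γ,Ĥ]`.»  § 1.2.2 (p0010): «The quantum Fisher information is additive under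
  product states for local evolutions … This implies the additivity of the quantum Fisher matrix:
  `𝐅_Q[ρ^{(1)}⊗⋯⊗ρ^{(N)}, Σ_i ĥ^{(i)}] = Σ_i 𝐅_Q[ρ^{(i)}, ĥ^{(i)}]`. … Additivity leads to a diagonal Fisher matrix
  for mode-product states: `𝐅_Q[ρ_1⊗⋯⊗ρ_M, Ĥ] = diag(F_Q[ρ_1,Ĥ_1], …, F_Q[ρ_M,Ĥ_M])`.»  § 1.2.3: «for pure states
  the quantum Fisher matrix coincides with four times the covariance matrix, i.e., `𝐅_Q[|ψ⟩,Ĥ] = 4𝚪[|ψ⟩,Ĥ]`, where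
  `(𝚪[ρ,Ĥ])_kl = Cov(Ĥ_k,Ĥ_l)_ρ`, with `Cov(Ĥ_k,Ĥ_l)_ρ = ½(⟨Ĥ_kĤ_l⟩_ρ + ⟨Ĥ_lĤ_k⟩_ρ) − ⟨Ĥ_k⟩_ρ⟨Ĥ_l⟩_ρ`. …
  the bilinearity property `Cov(Σ_k n_kĤ_k, Σ_l n_lĤ_l)_ρ = Σ_kl n_kn_l Cov(Ĥ_k,Ĥ_l)_ρ`, which implies
  `Δ(Ĥ·n)²_ρ = nᵀ𝚪[ρ,Ĥ]n`. For mixed states, the covariance yields an upper bound on the quantum Fisher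
  information [BraunsteinPRL1994], i.e., `F_Q[ρ,Ĥ·n] ≤ 4Δ(Ĥ·n)²_ρ`, for arbitrary `ρ`. Analogously, this implies the
  matrix inequality `𝐅_Q[ρ,Ĥ] ≤ 4𝚪[ρ,Ĥ]`, for arbitrary `ρ`.»  § 1.2.4: «in contrast to the quantum Fisher matrix,
  which is convex, the covariance matrix is concave: `𝚪[Σ_γ p_γρ_γ, Ĥ] ≥ Σ_γ p_γ𝚪[ρ_γ,Ĥ]`. To see this recall that
  for a linear combination of quantum states … the variance is concave».  § 1.2.5: «The covariance matrix is upper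
  bounded by: `𝚪[ρ,Ĥ] ≤ 𝚪̃[ρ,Ĥ]`, where `(𝚪̃[ρ,Ĥ])_kl = ½(⟨Ĥ_kĤ_l⟩_ρ + ⟨Ĥ_lĤ_k⟩_ρ)` contains only the fluctuations.
  This can be immediately demonstrated noticing that `𝚪̃[ρ,Ĥ] − 𝚪[ρ,Ĥ] = hhᵀ`, where `h = (H_1,…,H_M)` is the
  vector of mean values `H_k = ⟨Ĥ_k⟩_ρ`. The above matrix is of rank one with eigenvalue `hᵀh = Σ_k H_k²`, which is
  clearly non-negative.»

## Roads (no definitions introduced)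

Every matrix statement is the corresponding one-parameter theorem of the tree for the direction `n` (the paper's
own argument «which holds for all `n`»): the generator of the direction is `H_n = Σ_k n_kH_k`, its derivative
`Σ_k n_k∂_kρ = i(ρH_n − H_nρ)` (`unitaryDeriv_sum_smul`), its SLD `Σ_k n_kS_k` (g80-#1 `sld_sum_smul`); quadratic
forms `nᵀFn = F_Q[ρ,Ĥ·n]` (g80-#1 `dotProduct_qfim_mulVec`) and `nᵀΓn = (ΔH_n)²`; then
`F_Q ≤ 4(ΔH)²` is g79 `QFIVariance.qfi_le_four_variance`, `F_Q = 4(ΔH)²` for pure states is g79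
`QFICriterion.qfi_pure_eq_four_variance`, additivity is g79 `QFIProperties.qfi_kronecker`, and the weak bounds are
g80-#2 `sq_dotProduct_le_cov_mul_cfim/qfim` at `f = g = n`.  Matrix EQUALITIES are transported by the polarisation
lemma `ext_of_dotProduct_mulVec_eq` (two real symmetric matrices with the same quadratic form coincide).

## What is formalized (all PROVED)

* § 0 `ext_of_dotProduct_mulVec_eq` (polarisation), `dotProduct_single_add_single_mulVec`.
* § 1 `unitaryDeriv_sum_smul`, **`dotProduct_qfim_mulVec_unitary`** (`nᵀ𝐅_Qn = F_Q[ρ,Ĥ·n]`).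
* § 2 `re_trace_mul_sum_smul`, `re_trace_mul_sum_smul_mul_sum_smul`, **`dotProduct_covMatrix_mulVec`**
  (`nᵀ𝚪n = Δ(Ĥ·n)²`), `covMatrix_isHermitian`, `variance_eq_re_trace_mul_sq_sub`, `variance_nonneg`,
  `covMatrix_posSemidef`.
* § 3 **`qfim_eq_four_covMatrix_of_pure`** (`𝐅_Q[|ψ⟩,Ĥ] = 4𝚪[|ψ⟩,Ĥ]`), **`four_covMatrix_sub_qfim_posSemidef`**
  (`𝐅_Q ≤ 4𝚪`).
* § 4 **`covMatrix_sub_sum_covMatrix_posSemidef`** (concavity), `secondMoment_sub_covMatrix_eq_vecMulVec`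
  (`𝚪̃ − 𝚪 = hhᵀ`), **`secondMoment_sub_covMatrix_posSemidef`** (`𝚪 ≤ 𝚪̃`), `dotProduct_vecMulVec_mulVec`
  («eigenvalue `hᵀh`»: `nᵀ(hhᵀ)n = (hᵀn)²`).
* § 5 **`one_le_cov_mul_cfim_of_unit`**, **`one_le_cov_mul_qfim_of_unit`** (the weak CRB/QCRB for `|n|² = 1`,
  no inverses), `sq_dotProduct_self_le_inv_mul` (`(nᵀn)² ≤ (nᵀF⁻¹n)(nᵀFn)` for `F ≻ 0`),
  **`one_div_dotProduct_le_dotProduct_inv`** («`nᵀ𝐅⁻¹n ≥ (nᵀ𝐅n)⁻¹`»), `weak_le_matrix_bound`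
  (`1/(nᵀFn) ≤ nᵀF⁻¹n ≤ nᵀΣn`: the weak bound is weaker).
* § 6 **`qfim_kronecker`** (additivity `𝐅_Q[ρ₁⊗ρ₂, ĥ^{(1)}⊗1 + 1⊗ĥ^{(2)}] = 𝐅_Q[ρ₁,ĥ^{(1)}] + 𝐅_Q[ρ₂,ĥ^{(2)}]`, binary
  case of (QFMaddP)), **`qfim_kronecker_offDiag_eq_zero`** (mode-product states: the QFIM entry linking a generator
  on mode 1 with a generator on mode 2 vanishes — the diagonal form (QFMmodes) for two modes).

NOT formalized: the `N`-fold / `M`-fold tensor statements beyond the binary case, the shot-noise and Heisenberg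
matrices `𝐅_SN`, `𝐅_HL` and their saturating states, the separability bounds (psep)/(Λ-sep) (they need the register
formalism; the one-parameter `F_Q[ρ_sep, J_l] ≤ N` is `QFICriterion.qfi_le_of_isSeparable`), the upper covariance
limit `𝚪^ε`.  Tree search (FAIL-DUP, 2026-09-01): `rg -il "covariance matrix" Literature/InformationTheory` → Gaussian
/ classical uses only; the QFIM itself entered the tree with p24 g80-#1.
-/

noncomputable section

open Matrix Finset
open scoped ComplexOrder ComplexConjugate Kronecker

namespace Literature.InformationTheory.StateDiscrimination.QFIMCovariance

open Literature.InformationTheory.StateDiscrimination.QFIM (sld_sum_smul isHermitian_sum_smul dotProduct_qfim_mulVec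
  qfim_isHermitian qfim_posSemidef two_mul_re_trace_sum_smul_mul_sum_smul)
open Literature.InformationTheory.StateDiscrimination.QFIVariance (qfi_le_four_variance unitaryDeriv_isHermitian)
open Literature.InformationTheory.StateDiscrimination.MultiparameterQCRB (sq_dotProduct_le_cov_mul_qfim
  sq_dotProduct_le_cov_mul_cfim sq_sum_le_sum_mul_sum cov_posSemidef prob_nonneg)
open Literature.InformationTheory.StateDiscrimination.QFIProperties (qfi_kronecker)
open Literature.InformationTheory.Entanglement.QFICriterion (qfi_pure_eq_four_variance)
open Literature.LinearAlgebra.Matrix (norm_sq_le_of_fromBlocks_posSemidef re_trace_mul_nonneg_of_posSemidef)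

variable {n ι : Type*} [Fintype n] [DecidableEq n] [Fintype ι]

/-! ## § 0 Polarisation for real symmetric matrices -/

omit [Fintype n] [DecidableEq n] in
/-- `(e_i + e_j)ᵀ M (e_i + e_j) = M_ii + M_ij + M_ji + M_jj`. [folklore] -/
private theorem dotProduct_single_add_single_mulVec [DecidableEq ι] (M : Matrix ι ι ℝ) (i j : ι) :
    (Pi.single i 1 + Pi.single j 1) ⬝ᵥ (M *ᵥ (Pi.single i 1 + Pi.single j 1)) = M i i + M i j + M j i + M j j := by
  simp only [mulVec_add, dotProduct_add, add_dotProduct, mulVec_single_one, single_dotProduct, one_mul, col_apply]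
  ring

omit [Fintype n] [DecidableEq n] in
/-- **Polarisation**: two real symmetric matrices with the same quadratic form are equal («… which holds for all
`n`» — the step by which the paper turns one-parameter identities into matrix identities).
[cite: GessnerPezzeSmerzi2018, Supplement §1.2 («This follows since … holds for all `n`»)] -/
theorem ext_of_dotProduct_mulVec_eq {A B : Matrix ι ι ℝ} (hA : A.IsHermitian) (hB : B.IsHermitian)
    (h : ∀ x : ι → ℝ, x ⬝ᵥ (A *ᵥ x) = x ⬝ᵥ (B *ᵥ x)) : A = B := by
  classical
  ext i j
  have hd : ∀ (M : Matrix ι ι ℝ) (i : ι), Pi.single i 1 ⬝ᵥ (M *ᵥ Pi.single i 1) = M i i := fun M i => by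
    simp only [mulVec_single_one, single_dotProduct, one_mul, col_apply]
  have h1 := h (Pi.single i 1 + Pi.single j 1)
  rw [dotProduct_single_add_single_mulVec, dotProduct_single_add_single_mulVec] at h1
  have h2 := h (Pi.single i 1)
  have h3 := h (Pi.single j 1)
  rw [hd, hd] at h2 h3
  have hAs : A j i = A i j := by simpa only [star_trivial] using hA.apply i j
  have hBs : B j i = B i j := by simpa only [star_trivial] using hB.apply i j
  linarith

/-- `(2z).re = 2 z.re`. [folklore] -/
private theorem re_two_mul (z : ℂ) : (2 * z).re = 2 * z.re := by
  simp only [Complex.mul_re, Complex.re_ofNat, Complex.im_ofNat, zero_mul, sub_zero]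

/-! ## § 1 The unitary family: `Σ_k n_k∂_kρ = i(ρH_n − H_nρ)` and `nᵀ𝐅_Qn = F_Q[ρ, Ĥ·n]` -/

omit [DecidableEq n] in
/-- **The derivative along a direction is the derivative for the generator `H_n = Σ_k n_kH_k`**:
`Σ_k n_k · i(ρH_k − H_kρ) = i(ρH_n − H_nρ)`. [cite: GessnerPezzeSmerzi2018, Supplement §1.2 («`exp(−iĤ·θ) = exp(−iθ₀Ĥ·n)`»)] -/
theorem unitaryDeriv_sum_smul (ρ : Matrix n n ℂ) (H : ι → Matrix n n ℂ) (c : ι → ℝ) :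
    ∑ k, (c k : ℂ) • (Complex.I • (ρ * H k - H k * ρ)) =
      Complex.I • (ρ * (∑ k, (c k : ℂ) • H k) - (∑ k, (c k : ℂ) • H k) * ρ) := by
  rw [Finset.mul_sum, Finset.sum_mul, ← Finset.sum_sub_distrib, Finset.smul_sum]
  refine Finset.sum_congr rfl fun k _ => ?_
  rw [Matrix.mul_smul, Matrix.smul_mul, ← smul_sub, smul_comm]

omit [DecidableEq n] in
/-- **`F_Q[ρ, Ĥ·n] = nᵀ𝐅_Q[ρ,Ĥ]n`**: the quadratic form of the QFIM at `n` is the one-parameter QFI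
`2 Re Tr(S_n · i(ρH_n − H_nρ))` of the generator `H_n = Σ n_kH_k` with its SLD `S_n = Σ n_kS_k`.
[cite: GessnerPezzeSmerzi2018, Supplement §1.2 («`F_Q[ρ,Ĥ·n] = nᵀ𝐅_Q[ρ,Ĥ]n`»)] -/
theorem dotProduct_qfim_mulVec_unitary {ρ : Matrix n n ℂ} {H S : ι → Matrix n n ℂ} {F : Matrix ι ι ℝ}
    (hF : ∀ k l, F k l = 2 * (S k * (Complex.I • (ρ * H l - H l * ρ))).trace.re) (c : ι → ℝ) :
    c ⬝ᵥ (F *ᵥ c) = 2 * ((∑ k, (c k : ℂ) • S k) *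
      (Complex.I • (ρ * (∑ k, (c k : ℂ) • H k) - (∑ k, (c k : ℂ) • H k) * ρ))).trace.re := by
  rw [dotProduct_qfim_mulVec hF, unitaryDeriv_sum_smul]

omit [DecidableEq n] in
/-- The SLD of the direction: `S_n ρ + ρ S_n = i(ρH_n − H_nρ)`. [cite: GessnerPezzeSmerzi2018, Supplement §1.2] -/
theorem sld_sum_smul_unitary {ρ : Matrix n n ℂ} {H S : ι → Matrix n n ℂ}
    (hSD : ∀ k, S k * ρ + ρ * S k = Complex.I • (ρ * H k - H k * ρ)) (c : ι → ℝ) :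
    (∑ k, (c k : ℂ) • S k) * ρ + ρ * (∑ k, (c k : ℂ) • S k) =
      Complex.I • (ρ * (∑ k, (c k : ℂ) • H k) - (∑ k, (c k : ℂ) • H k) * ρ) := by
  rw [sld_sum_smul c hSD, unitaryDeriv_sum_smul]

/-! ## § 2 The covariance matrix `𝚪` of the generators: `nᵀ𝚪n = Δ(Ĥ·n)²`, `𝚪 ⪰ 0` -/

omit [DecidableEq n] in
/-- Linearity of the mean: `Re Tr(ρ Σ_k n_kH_k) = Σ_k n_k Re Tr(ρH_k)`. [cite: GessnerPezzeSmerzi2018, Supplement §1.2.3 (bilinearity)] -/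
theorem re_trace_mul_sum_smul (ρ : Matrix n n ℂ) (H : ι → Matrix n n ℂ) (c : ι → ℝ) :
    (ρ * ∑ k, (c k : ℂ) • H k).trace.re = ∑ k, c k * (ρ * H k).trace.re := by
  simp only [Finset.mul_sum, Matrix.mul_smul, trace_sum, trace_smul, smul_eq_mul, Complex.re_sum, Complex.mul_re,
    Complex.ofReal_re, Complex.ofReal_im, zero_mul, sub_zero]

omit [DecidableEq n] in
/-- Bilinearity of the second moment: `Re Tr(ρ H_nH_n) = Σ_kl n_kn_l Re Tr(ρH_kH_l)`.
[cite: GessnerPezzeSmerzi2018, Supplement §1.2.3 («`Cov(Σ_k n_kĤ_k, Σ_l n_lĤ_l)_ρ = Σ_kl n_kn_l Cov(Ĥ_k,Ĥ_l)_ρ`»)] -/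
theorem re_trace_mul_sum_smul_mul_sum_smul (ρ : Matrix n n ℂ) (H : ι → Matrix n n ℂ) (c : ι → ℝ) :
    (ρ * (∑ k, (c k : ℂ) • H k) * (∑ l, (c l : ℂ) • H l)).trace.re =
      ∑ k, ∑ l, c k * c l * (ρ * H k * H l).trace.re := by
  have e : (∑ k, (c k : ℂ) • (ρ * H k)) = ρ * ∑ k, (c k : ℂ) • H k := by
    rw [Finset.mul_sum]
    exact Finset.sum_congr rfl fun k _ => (Matrix.mul_smul ρ (c k : ℂ) (H k)).symm
  have h := two_mul_re_trace_sum_smul_mul_sum_smul c c (fun k => ρ * H k) H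
  rw [e] at h
  have h2 : ∑ k, ∑ l, c k * c l * (2 * (ρ * H k * H l).trace.re) =
      2 * ∑ k, ∑ l, c k * c l * (ρ * H k * H l).trace.re := by
    rw [Finset.mul_sum]
    refine Finset.sum_congr rfl fun k _ => ?_
    rw [Finset.mul_sum]
    exact Finset.sum_congr rfl fun l _ => by ring
  linarith

omit [DecidableEq n] in
/-- **`Δ(Ĥ·n)²_ρ = nᵀ𝚪[ρ,Ĥ]n`** (bilinearity of the covariance): with
`Γ_kl = ½Re Tr(ρ(H_kH_l + H_lH_k)) − ⟨H_k⟩⟨H_l⟩` and `H_n = Σ n_kH_k`,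
`nᵀΓn = Re Tr(ρH_n²) − (Re Tr(ρH_n))²`. [cite: GessnerPezzeSmerzi2018, Supplement §1.2.3 («`Δ(Ĥ·n)²_ρ = nᵀ𝚪[ρ,Ĥ]n`»)] -/
theorem dotProduct_covMatrix_mulVec {ρ : Matrix n n ℂ} {H : ι → Matrix n n ℂ} {Γ : Matrix ι ι ℝ}
    (hΓ : ∀ k l, Γ k l = (ρ * (H k * H l + H l * H k)).trace.re / 2 - (ρ * H k).trace.re * (ρ * H l).trace.re)
    (c : ι → ℝ) :
    c ⬝ᵥ (Γ *ᵥ c) = (ρ * ((∑ k, (c k : ℂ) • H k) * (∑ k, (c k : ℂ) • H k))).trace.re -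
      (ρ * ∑ k, (c k : ℂ) • H k).trace.re ^ 2 := by
  rw [← Matrix.mul_assoc, re_trace_mul_sum_smul_mul_sum_smul, re_trace_mul_sum_smul, pow_two, Finset.sum_mul_sum]
  -- symmetrise the second-moment double sum
  have hswap : ∑ k, ∑ l, c k * c l * (ρ * H k * H l).trace.re = ∑ k, ∑ l, c k * c l * (ρ * H l * H k).trace.re := by
    rw [Finset.sum_comm]
    exact Finset.sum_congr rfl fun k _ => Finset.sum_congr rfl fun l _ => by ring
  have hsymm : ∑ k, ∑ l, c k * c l * (ρ * H k * H l).trace.re =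
      ∑ k, ∑ l, c k * c l * ((ρ * (H k * H l + H l * H k)).trace.re / 2) := by
    have e : ∀ k l, (ρ * (H k * H l + H l * H k)).trace.re = (ρ * H k * H l).trace.re + (ρ * H l * H k).trace.re := by
      intro k l
      rw [Matrix.mul_add, trace_add, Complex.add_re, ← Matrix.mul_assoc, ← Matrix.mul_assoc]
    simp_rw [e]
    have hsplit : ∑ k, ∑ l, c k * c l * (((ρ * H k * H l).trace.re + (ρ * H l * H k).trace.re) / 2) =
        (∑ k, ∑ l, c k * c l * (ρ * H k * H l).trace.re + ∑ k, ∑ l, c k * c l * (ρ * H l * H k).trace.re) / 2 := by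
      rw [← Finset.sum_add_distrib, Finset.sum_div]
      refine Finset.sum_congr rfl fun k _ => ?_
      rw [← Finset.sum_add_distrib, Finset.sum_div]
      exact Finset.sum_congr rfl fun l _ => by ring
    rw [hsplit, ← hswap]
    ring
  rw [hsymm]
  simp only [dotProduct, mulVec, hΓ, Finset.mul_sum, ← Finset.sum_sub_distrib]
  refine Finset.sum_congr rfl fun k _ => Finset.sum_congr rfl fun l _ => ?_
  ring

omit [Fintype n] [DecidableEq n] [Fintype ι] in
/-- The covariance matrix is symmetric (Hermitian as a real matrix). [cite: GessnerPezzeSmerzi2018, Supplement §1.2.3] -/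
theorem covMatrix_isHermitian {m : Type*} [Fintype m] {ρ : Matrix m m ℂ} {H : ι → Matrix m m ℂ} {Γ : Matrix ι ι ℝ}
    (hΓ : ∀ k l, Γ k l = (ρ * (H k * H l + H l * H k)).trace.re / 2 - (ρ * H k).trace.re * (ρ * H l).trace.re) :
    Γ.IsHermitian := by
  ext k l
  rw [conjTranspose_apply, star_trivial, hΓ, hΓ, add_comm, mul_comm ((ρ * H l).trace.re)]

omit [DecidableEq n] in
/-- The mean of a Hermitian observable in a Hermitian `ρ` is real: `((Re Tr(ρA) : ℂ) = Tr(ρA)`. [folklore] -/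
private theorem ofReal_re_trace_mul {ρ A : Matrix n n ℂ} (hρ : ρ.IsHermitian) (hA : A.IsHermitian) :
    ((ρ * A).trace.re : ℂ) = (ρ * A).trace := by
  refine Complex.ext (by simp) ?_
  rw [Complex.ofReal_im]
  have h : star (ρ * A).trace = (ρ * A).trace := by
    rw [← trace_conjTranspose, conjTranspose_mul, hρ.eq, hA.eq, Matrix.trace_mul_comm]
  rw [Complex.star_def] at h
  exact (Complex.conj_eq_iff_im.mp h).symm

/-- **The variance as the mean of a square**: `(ΔA)² = Re Tr(ρA²) − (Re Tr(ρA))² = Re Tr(ρ(A − ⟨A⟩)²)` for a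
Hermitian `ρ` of unit trace and Hermitian `A`. [cite: GessnerPezzeSmerzi2018, Supplement §1.2.3 («the variance»)] -/
theorem variance_eq_re_trace_mul_sq_sub {ρ A : Matrix n n ℂ} (hρ : ρ.IsHermitian) (hρ1 : ρ.trace = 1)
    (hA : A.IsHermitian) :
    (ρ * (A * A)).trace.re - (ρ * A).trace.re ^ 2 =
      (ρ * ((A - ((ρ * A).trace.re : ℂ) • (1 : Matrix n n ℂ)) * (A - ((ρ * A).trace.re : ℂ) • (1 : Matrix n n ℂ)))).trace.re := by
  set c : ℝ := (ρ * A).trace.re with hc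
  have e : (A - (c : ℂ) • (1 : Matrix n n ℂ)) * (A - (c : ℂ) • (1 : Matrix n n ℂ)) =
      A * A - (2 * (c : ℂ)) • A + ((c : ℂ) * c) • (1 : Matrix n n ℂ) := by
    simp only [Matrix.mul_sub, Matrix.sub_mul, Matrix.mul_smul, Matrix.smul_mul, Matrix.mul_one, Matrix.one_mul]
    module
  rw [e]
  simp only [Matrix.mul_add, Matrix.mul_sub, Matrix.mul_smul, trace_add, trace_sub, trace_smul, hρ1,
    smul_eq_mul, mul_one]
  rw [← ofReal_re_trace_mul hρ hA, ← hc]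
  simp only [Complex.add_re, Complex.sub_re, Complex.mul_re, Complex.ofReal_re, Complex.ofReal_im, Complex.re_ofNat,
    Complex.im_ofNat, mul_zero, sub_zero]
  ring

/-- **`(ΔA)² ≥ 0`** for a state `ρ ⪰ 0` of unit trace and Hermitian `A` (`(A − ⟨A⟩)² ⪰ 0`).
[cite: GessnerPezzeSmerzi2018, main text («`𝐅` and `𝐅_Q` are positive semi-definite matrices»), Supplement §1.2.3] -/
theorem variance_nonneg {ρ A : Matrix n n ℂ} (hρ : ρ.PosSemidef) (hρ1 : ρ.trace = 1) (hA : A.IsHermitian) :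
    0 ≤ (ρ * (A * A)).trace.re - (ρ * A).trace.re ^ 2 := by
  rw [variance_eq_re_trace_mul_sq_sub hρ.1 hρ1 hA]
  have hB : (A - ((ρ * A).trace.re : ℂ) • (1 : Matrix n n ℂ)).IsHermitian := by
    unfold Matrix.IsHermitian
    rw [conjTranspose_sub, conjTranspose_smul, conjTranspose_one, hA.eq, Complex.star_def, Complex.conj_ofReal]
  have hsq : ((A - ((ρ * A).trace.re : ℂ) • (1 : Matrix n n ℂ)) *
      (A - ((ρ * A).trace.re : ℂ) • (1 : Matrix n n ℂ))).PosSemidef := by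
    nth_rewrite 1 [← hB.eq]
    exact posSemidef_conjTranspose_mul_self _
  exact re_trace_mul_nonneg_of_posSemidef hρ hsq

/-- **The covariance matrix of Hermitian generators in a state is positive semidefinite** (`nᵀ𝚪n = Δ(Ĥ·n)² ≥ 0`).
[cite: GessnerPezzeSmerzi2018, Supplement §1.2.3 («`Δ(Ĥ·n)²_ρ = nᵀ𝚪[ρ,Ĥ]n`»)] -/
theorem covMatrix_posSemidef {ρ : Matrix n n ℂ} (hρ : ρ.PosSemidef) (hρ1 : ρ.trace = 1) {H : ι → Matrix n n ℂ}
    (hH : ∀ k, (H k).IsHermitian) {Γ : Matrix ι ι ℝ}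
    (hΓ : ∀ k l, Γ k l = (ρ * (H k * H l + H l * H k)).trace.re / 2 - (ρ * H k).trace.re * (ρ * H l).trace.re) :
    Γ.PosSemidef := by
  refine PosSemidef.of_dotProduct_mulVec_nonneg (covMatrix_isHermitian hΓ) fun c => ?_
  rw [star_trivial, dotProduct_covMatrix_mulVec hΓ]
  exact variance_nonneg hρ hρ1 (isHermitian_sum_smul c hH)

/-! ## § 3 `𝐅_Q = 4𝚪` for pure states and `𝐅_Q ≤ 4𝚪` for all states (Supplement § 1.2.3; main text) -/

omit [DecidableEq n] in
/-- **`𝐅_Q[|ψ⟩,Ĥ] = 4𝚪[|ψ⟩,Ĥ]`** for a pure state `ρ = |ψ⟩⟨ψ|` (`⟨ψ|ψ⟩ = 1`), Hermitian generators and any Hermitian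
SLDs: the QFIM IS four times the covariance matrix. [cite: GessnerPezzeSmerzi2018, Supplement §1.2.3 («`𝐅_Q[|ψ⟩,Ĥ] = 4𝚪[|ψ⟩,Ĥ]`»)] -/
theorem qfim_eq_four_covMatrix_of_pure {ψ : n → ℂ} (hψ : star ψ ⬝ᵥ ψ = 1) {H S : ι → Matrix n n ℂ}
    (hH : ∀ k, (H k).IsHermitian) (hS : ∀ k, (S k).IsHermitian)
    (hSD : ∀ k, S k * vecMulVec ψ (star ψ) + vecMulVec ψ (star ψ) * S k =
      Complex.I • (vecMulVec ψ (star ψ) * H k - H k * vecMulVec ψ (star ψ)))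
    {F Γ : Matrix ι ι ℝ}
    (hF : ∀ k l, F k l = 2 * (S k * (Complex.I • (vecMulVec ψ (star ψ) * H l - H l * vecMulVec ψ (star ψ)))).trace.re)
    (hΓ : ∀ k l, Γ k l = (vecMulVec ψ (star ψ) * (H k * H l + H l * H k)).trace.re / 2 -
      (vecMulVec ψ (star ψ) * H k).trace.re * (vecMulVec ψ (star ψ) * H l).trace.re) :
    F = (4 : ℝ) • Γ := by
  have h4 : ((4 : ℝ) • Γ).IsHermitian := by
    unfold Matrix.IsHermitian; rw [conjTranspose_smul, star_trivial, (covMatrix_isHermitian hΓ).eq]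
  refine ext_of_dotProduct_mulVec_eq (qfim_isHermitian hSD hF) h4 fun c => ?_
  rw [smul_mulVec, dotProduct_smul, smul_eq_mul, dotProduct_covMatrix_mulVec hΓ, dotProduct_qfim_mulVec_unitary hF]
  have h := qfi_pure_eq_four_variance (isHermitian_sum_smul c hH) (isHermitian_sum_smul c hS) hψ
    (sld_sum_smul_unitary hSD c)
  rw [re_two_mul] at h
  rw [h, Matrix.trace_mul_comm, Literature.InformationTheory.StateDiscrimination.QFI.trace_mul_ketbra,
    Matrix.trace_mul_comm, Literature.InformationTheory.StateDiscrimination.QFI.trace_mul_ketbra]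

/-- **`𝐅_Q[ρ,Ĥ] ≤ 4𝚪[ρ,Ĥ]` for arbitrary states** (main text; Supplement (QFMvar)): `4𝚪 − 𝐅_Q ⪰ 0` for `ρ ⪰ 0` of
unit trace, Hermitian generators and Hermitian SLDs. [cite: GessnerPezzeSmerzi2018, main text («The state-dependent bound `𝐅_Q[ρ,Ĥ] ≤ 4𝚪[ρ,Ĥ]` holds for arbitrary quantum states»), Supplement §1.2.3] -/
theorem four_covMatrix_sub_qfim_posSemidef {ρ : Matrix n n ℂ} (hρ : ρ.PosSemidef) (hρ1 : ρ.trace = 1)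
    {H S : ι → Matrix n n ℂ} (hH : ∀ k, (H k).IsHermitian) (hS : ∀ k, (S k).IsHermitian)
    (hSD : ∀ k, S k * ρ + ρ * S k = Complex.I • (ρ * H k - H k * ρ)) {F Γ : Matrix ι ι ℝ}
    (hF : ∀ k l, F k l = 2 * (S k * (Complex.I • (ρ * H l - H l * ρ))).trace.re)
    (hΓ : ∀ k l, Γ k l = (ρ * (H k * H l + H l * H k)).trace.re / 2 - (ρ * H k).trace.re * (ρ * H l).trace.re) :
    ((4 : ℝ) • Γ - F).PosSemidef := by
  have h4 : ((4 : ℝ) • Γ).IsHermitian := by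
    unfold Matrix.IsHermitian; rw [conjTranspose_smul, star_trivial, (covMatrix_isHermitian hΓ).eq]
  refine PosSemidef.of_dotProduct_mulVec_nonneg (h4.sub (qfim_isHermitian hSD hF)) fun c => ?_
  rw [star_trivial, sub_mulVec, dotProduct_sub, smul_mulVec, dotProduct_smul, smul_eq_mul, sub_nonneg,
    dotProduct_covMatrix_mulVec hΓ, dotProduct_qfim_mulVec_unitary hF]
  have h := qfi_le_four_variance hρ hρ1 (isHermitian_sum_smul c hH) (isHermitian_sum_smul c hS)
    (sld_sum_smul_unitary hSD c)
  rw [re_two_mul] at h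
  exact h

/-! ## § 4 Concavity of `𝚪` and the rank-one bound `𝚪 ≤ 𝚪̃` (Supplement § 1.2.4, § 1.2.5) -/

omit [DecidableEq n] in
/-- **Concavity of the covariance matrix**: for states `ρ_γ` of unit trace, weights `p_γ ≥ 0` with `Σ p_γ = 1` and
the mixture `ρ = Σ p_γρ_γ`, `𝚪[ρ,Ĥ] − Σ_γ p_γ𝚪[ρ_γ,Ĥ] ⪰ 0` (the quadratic form at `n` is
`Σ_γ p_γ⟨H_n⟩²_γ − (Σ_γ p_γ⟨H_n⟩_γ)² ≥ 0`). [cite: GessnerPezzeSmerzi2018, Supplement §1.2.4 («the covariance matrix is concave: `𝚪[Σ_γp_γρ_γ,Ĥ] ≥ Σ_γ p_γ𝚪[ρ_γ,Ĥ]`»)] -/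
theorem covMatrix_sub_sum_covMatrix_posSemidef {m : Type*} [Fintype m] {p : m → ℝ} (hp : ∀ γ, 0 ≤ p γ)
    (hp1 : ∑ γ, p γ = 1) {ρ : m → Matrix n n ℂ} {H : ι → Matrix n n ℂ} {Γi : m → Matrix ι ι ℝ} {Γ : Matrix ι ι ℝ}
    (hΓi : ∀ γ k l, Γi γ k l =
      (ρ γ * (H k * H l + H l * H k)).trace.re / 2 - (ρ γ * H k).trace.re * (ρ γ * H l).trace.re)
    (hΓ : ∀ k l, Γ k l = ((∑ γ, (p γ : ℂ) • ρ γ) * (H k * H l + H l * H k)).trace.re / 2 -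
      ((∑ γ, (p γ : ℂ) • ρ γ) * H k).trace.re * ((∑ γ, (p γ : ℂ) • ρ γ) * H l).trace.re) :
    (Γ - ∑ γ, p γ • Γi γ).PosSemidef := by
  have hsumh : (∑ γ, p γ • Γi γ).IsHermitian := by
    unfold Matrix.IsHermitian
    rw [conjTranspose_sum]
    exact Finset.sum_congr rfl fun γ _ => by rw [conjTranspose_smul, star_trivial, (covMatrix_isHermitian (hΓi γ)).eq]
  refine PosSemidef.of_dotProduct_mulVec_nonneg ((covMatrix_isHermitian hΓ).sub hsumh) fun c => ?_
  have hq : ∀ γ, c ⬝ᵥ (Γi γ *ᵥ c) = (ρ γ * ((∑ k, (c k : ℂ) • H k) * (∑ k, (c k : ℂ) • H k))).trace.re -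
      (ρ γ * ∑ k, (c k : ℂ) • H k).trace.re ^ 2 := fun γ => dotProduct_covMatrix_mulVec (hΓi γ) c
  rw [star_trivial, sub_mulVec, dotProduct_sub, sum_mulVec, dotProduct_sum]
  simp_rw [smul_mulVec, dotProduct_smul, smul_eq_mul, hq, dotProduct_covMatrix_mulVec hΓ c]
  -- means are linear in the state
  set A : Matrix n n ℂ := (∑ k, (c k : ℂ) • H k) * (∑ k, (c k : ℂ) • H k)
  set B : Matrix n n ℂ := ∑ k, (c k : ℂ) • H k
  have hlin : ∀ X : Matrix n n ℂ, ((∑ γ, (p γ : ℂ) • ρ γ) * X).trace.re = ∑ γ, p γ * (ρ γ * X).trace.re := by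
    intro X
    simp only [Finset.sum_mul, Matrix.smul_mul, trace_sum, trace_smul, smul_eq_mul, Complex.re_sum, Complex.mul_re,
      Complex.ofReal_re, Complex.ofReal_im, zero_mul, sub_zero]
  rw [hlin A, hlin B]
  simp_rw [mul_sub, Finset.sum_sub_distrib]
  -- `Σ p a² − (Σ p a)² ≥ 0`
  have hcs := sq_sum_le_sum_mul_sum (c := fun γ => p γ * (ρ γ * B).trace.re) (a := p)
    (b := fun γ => p γ * (ρ γ * B).trace.re ^ 2) hp (fun γ => mul_nonneg (hp γ) (sq_nonneg _))
    (fun γ => le_of_eq (by ring))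
  rw [hp1, one_mul] at hcs
  linarith

omit [Fintype n] [DecidableEq n] [Fintype ι] in
/-- **`𝚪̃ − 𝚪 = hhᵀ`** with `h_k = ⟨H_k⟩ = Re Tr(ρH_k)`. [cite: GessnerPezzeSmerzi2018, Supplement §1.2.5 («`𝚪̃[ρ,Ĥ] − 𝚪[ρ,Ĥ] = hhᵀ`»)] -/
theorem secondMoment_sub_covMatrix_eq_vecMulVec {m : Type*} [Fintype m] {ρ : Matrix m m ℂ} {H : ι → Matrix m m ℂ}
    {Γ Γ' : Matrix ι ι ℝ}
    (hΓ : ∀ k l, Γ k l = (ρ * (H k * H l + H l * H k)).trace.re / 2 - (ρ * H k).trace.re * (ρ * H l).trace.re)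
    (hΓ' : ∀ k l, Γ' k l = (ρ * (H k * H l + H l * H k)).trace.re / 2) :
    Γ' - Γ = vecMulVec (fun k => (ρ * H k).trace.re) (fun k => (ρ * H k).trace.re) := by
  ext k l
  rw [Matrix.sub_apply, hΓ, hΓ', vecMulVec_apply]
  ring

omit [Fintype n] [DecidableEq n] in
/-- «eigenvalue `hᵀh … clearly non-negative`»: `nᵀ(hhᵀ)n = (h·n)² ≥ 0`. [cite: GessnerPezzeSmerzi2018, Supplement §1.2.5] -/
theorem dotProduct_vecMulVec_mulVec (h c : ι → ℝ) : c ⬝ᵥ (vecMulVec h h *ᵥ c) = (h ⬝ᵥ c) ^ 2 := by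
  simp only [dotProduct, mulVec, vecMulVec_apply, pow_two]
  rw [Finset.sum_mul_sum]
  simp only [Finset.mul_sum]
  refine Finset.sum_congr rfl fun k _ => Finset.sum_congr rfl fun l _ => ?_
  ring

omit [Fintype n] [DecidableEq n] in
/-- **`𝚪 ≤ 𝚪̃`**: `𝚪̃ − 𝚪 = hhᵀ ⪰ 0`. [cite: GessnerPezzeSmerzi2018, Supplement §1.2.5 («The covariance matrix is upper bounded by: `𝚪[ρ,Ĥ] ≤ 𝚪̃[ρ,Ĥ]`»)] -/
theorem secondMoment_sub_covMatrix_posSemidef {m : Type*} [Fintype m] {ρ : Matrix m m ℂ} {H : ι → Matrix m m ℂ}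
    {Γ Γ' : Matrix ι ι ℝ}
    (hΓ : ∀ k l, Γ k l = (ρ * (H k * H l + H l * H k)).trace.re / 2 - (ρ * H k).trace.re * (ρ * H l).trace.re)
    (hΓ' : ∀ k l, Γ' k l = (ρ * (H k * H l + H l * H k)).trace.re / 2) : (Γ' - Γ).PosSemidef := by
  rw [secondMoment_sub_covMatrix_eq_vecMulVec hΓ hΓ']
  have h := posSemidef_vecMulVec_star_self (fun k => (ρ * H k).trace.re)
  rwa [star_trivial] at h

/-! ## § 5 The weak (inverse-free) Cramér–Rao bounds and «`nᵀ𝐅⁻¹n ≥ (nᵀ𝐅n)⁻¹`» (main text) -/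

section Weak

variable {Ω : Type*} [Fintype Ω] [DecidableEq ι]

/-- **Weak CRB `nᵀΣn · nᵀ𝐅n ≥ 1` for `|n|² = 1`** (no inverse of the CFIM needed): any POVM, locally unbiased
estimators, general derivative data with Hermitian SLDs (`f = g = n` in g80-#2's inverse-free form).
[cite: GessnerPezzeSmerzi2018, main text («`nᵀΣn ≥ 1/(μnᵀ𝐅n)` … can be derived without assuming the existence of the inverse»)] -/
theorem one_le_cov_mul_cfim_of_unit {ρ : Matrix n n ℂ} (hρ : ρ.PosSemidef) {S D : ι → Matrix n n ℂ}
    (hS : ∀ a, (S a).IsHermitian) (hSD : ∀ a, S a * ρ + ρ * S a = D a) (hD0 : ∀ a, (D a).trace.re = 0)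
    {M : Ω → Matrix n n ℂ} (hM : ∀ ω, (M ω).PosSemidef) (hM1 : ∑ ω, M ω = 1) (est : ι → Ω → ℝ) (θ : ι → ℝ)
    (hlu : ∀ a b, ∑ ω, est a ω * (D b * M ω).trace.re = if a = b then 1 else 0) {I V : Matrix ι ι ℝ}
    (hI : ∀ a b, I a b = ∑ ω, (D a * M ω).trace.re * (D b * M ω).trace.re / (ρ * M ω).trace.re)
    (hV : ∀ a b, V a b = ∑ ω, (ρ * M ω).trace.re * ((est a ω - θ a) * (est b ω - θ b))) {c : ι → ℝ}
    (hc : c ⬝ᵥ c = 1) : 1 ≤ (c ⬝ᵥ (V *ᵥ c)) * (c ⬝ᵥ (I *ᵥ c)) := by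
  have h := sq_dotProduct_le_cov_mul_cfim hρ hS hSD hD0 hM hM1 est θ hlu hI hV c c
  rwa [hc, one_pow] at h

/-- **Weak QCRB `nᵀΣn · nᵀ𝐅_Qn ≥ 1` for `|n|² = 1`** (no inverse of the QFIM needed).
[cite: GessnerPezzeSmerzi2018, main text («`nᵀΣn ≥ 1/(μ nᵀ𝐅n) ≥ 1/(μ nᵀ𝐅_Qn)`»)] -/
theorem one_le_cov_mul_qfim_of_unit {ρ : Matrix n n ℂ} (hρ : ρ.PosSemidef) {S D : ι → Matrix n n ℂ}
    (hS : ∀ a, (S a).IsHermitian) (hSD : ∀ a, S a * ρ + ρ * S a = D a) (hD0 : ∀ a, (D a).trace.re = 0)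
    {M : Ω → Matrix n n ℂ} (hM : ∀ ω, (M ω).PosSemidef) (hM1 : ∑ ω, M ω = 1) (est : ι → Ω → ℝ) (θ : ι → ℝ)
    (hlu : ∀ a b, ∑ ω, est a ω * (D b * M ω).trace.re = if a = b then 1 else 0) {F V : Matrix ι ι ℝ}
    (hF : ∀ a b, F a b = 2 * (S a * D b).trace.re)
    (hV : ∀ a b, V a b = ∑ ω, (ρ * M ω).trace.re * ((est a ω - θ a) * (est b ω - θ b))) {c : ι → ℝ}
    (hc : c ⬝ᵥ c = 1) : 1 ≤ (c ⬝ᵥ (V *ᵥ c)) * (c ⬝ᵥ (F *ᵥ c)) := by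
  have h := sq_dotProduct_le_cov_mul_qfim hρ hS hSD hD0 hM hM1 est θ hlu hF hV c c
  rwa [hc, one_pow] at h

/-- The weak QCRB as printed, `nᵀΣn ≥ 1/(nᵀ𝐅_Qn)`, when `nᵀ𝐅_Qn > 0`. [cite: GessnerPezzeSmerzi2018, main text (weak QCRB)] -/
theorem one_div_qfim_le_cov_of_unit {ρ : Matrix n n ℂ} (hρ : ρ.PosSemidef) {S D : ι → Matrix n n ℂ}
    (hS : ∀ a, (S a).IsHermitian) (hSD : ∀ a, S a * ρ + ρ * S a = D a) (hD0 : ∀ a, (D a).trace.re = 0)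
    {M : Ω → Matrix n n ℂ} (hM : ∀ ω, (M ω).PosSemidef) (hM1 : ∑ ω, M ω = 1) (est : ι → Ω → ℝ) (θ : ι → ℝ)
    (hlu : ∀ a b, ∑ ω, est a ω * (D b * M ω).trace.re = if a = b then 1 else 0) {F V : Matrix ι ι ℝ}
    (hF : ∀ a b, F a b = 2 * (S a * D b).trace.re)
    (hV : ∀ a b, V a b = ∑ ω, (ρ * M ω).trace.re * ((est a ω - θ a) * (est b ω - θ b))) {c : ι → ℝ}
    (hc : c ⬝ᵥ c = 1) (hpos : 0 < c ⬝ᵥ (F *ᵥ c)) : 1 / (c ⬝ᵥ (F *ᵥ c)) ≤ c ⬝ᵥ (V *ᵥ c) := by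
  rw [div_le_iff₀ hpos]
  exact one_le_cov_mul_qfim_of_unit hρ hS hSD hD0 hM hM1 est θ hlu hF hV hc

omit [Fintype n] [DecidableEq n] [Fintype Ω] in
/-- **`(nᵀn)² ≤ (nᵀF⁻¹n)(nᵀFn)`** for a real `F ≻ 0` (`[[F⁻¹,1],[1,F]] ⪰ 0` by the Schur complement, then
Horn–Johnson 7.7.11 at `x = y = n`). [cite: GessnerPezzeSmerzi2018, main text («`nᵀ𝐅⁻¹n ≥ (nᵀ𝐅n)⁻¹` holds for all `n` and all matrices `𝐅`, whenever `𝐅⁻¹` exists»)] -/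
theorem sq_dotProduct_self_le_inv_mul {F : Matrix ι ι ℝ} (hF : F.PosDef) (c : ι → ℝ) :
    (c ⬝ᵥ c) ^ 2 ≤ (c ⬝ᵥ (F⁻¹ *ᵥ c)) * (c ⬝ᵥ (F *ᵥ c)) := by
  letI : Invertible F := hF.isUnit.invertible
  have hblk : (fromBlocks F⁻¹ (1 : Matrix ι ι ℝ) (1 : Matrix ι ι ℝ)ᴴ F).PosSemidef := by
    rw [Matrix.PosDef.fromBlocks₂₂ F⁻¹ 1 hF, Matrix.one_mul, conjTranspose_one, Matrix.mul_one, sub_self]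
    exact PosSemidef.zero
  have h := norm_sq_le_of_fromBlocks_posSemidef hblk c c
  simpa only [star_trivial, one_mulVec, RCLike.re_to_real, Real.norm_eq_abs, sq_abs] using h

omit [Fintype n] [DecidableEq n] [Fintype Ω] in
/-- **«`nᵀ𝐅⁻¹n ≥ (nᵀ𝐅n)⁻¹`» for `|n|² = 1`** and `𝐅 ≻ 0`. [cite: GessnerPezzeSmerzi2018, main text] -/
theorem one_div_dotProduct_le_dotProduct_inv {F : Matrix ι ι ℝ} (hF : F.PosDef) {c : ι → ℝ} (hc : c ⬝ᵥ c = 1) :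
    1 / (c ⬝ᵥ (F *ᵥ c)) ≤ c ⬝ᵥ (F⁻¹ *ᵥ c) := by
  have hc0 : c ≠ 0 := by
    rintro rfl; simp at hc
  have hpos : 0 < c ⬝ᵥ (F *ᵥ c) := by
    have := hF.dotProduct_mulVec_pos hc0
    rwa [star_trivial] at this
  rw [div_le_iff₀ hpos]
  have h := sq_dotProduct_self_le_inv_mul hF c
  rwa [hc, one_pow] at h

omit [Fintype n] [DecidableEq n] [Fintype Ω] in
/-- **The weak bound is weaker than the matrix bound**: if `V − F⁻¹ ⪰ 0` (the matrix QCRB, `F ≻ 0`) then for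
`|n|² = 1`, `1/(nᵀFn) ≤ nᵀF⁻¹n ≤ nᵀVn`. [cite: GessnerPezzeSmerzi2018, main text («the chain of inequalities (weak) is weaker than (matrix)»)] -/
theorem weak_le_matrix_bound {F V : Matrix ι ι ℝ} (hF : F.PosDef) (hV : (V - F⁻¹).PosSemidef) {c : ι → ℝ}
    (hc : c ⬝ᵥ c = 1) : 1 / (c ⬝ᵥ (F *ᵥ c)) ≤ c ⬝ᵥ (F⁻¹ *ᵥ c) ∧ c ⬝ᵥ (F⁻¹ *ᵥ c) ≤ c ⬝ᵥ (V *ᵥ c) := by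
  refine ⟨one_div_dotProduct_le_dotProduct_inv hF hc, ?_⟩
  have h := hV.dotProduct_mulVec_nonneg c
  rw [star_trivial, sub_mulVec, dotProduct_sub, sub_nonneg] at h
  exact h

end Weak

/-! ## § 6 Additivity under tensor products and the diagonal form for mode-product states (Supplement § 1.2.2) -/

section Kronecker

variable {m k : Type*} [Fintype m] [DecidableEq m] [Fintype k] [DecidableEq k]

omit [Fintype n] [DecidableEq n] [Fintype ι] in
/-- **Additivity of the QFIM (particle representation, two particles)**: for `ρ₁ ⊗ ρ₂` (unit traces) and local
generators `H_k = h^{(1)}_k ⊗ 1 + 1 ⊗ h^{(2)}_k`, with the SLDs `S^{(1)}_k ⊗ 1 + 1 ⊗ S^{(2)}_k` (g79 `sld_kronecker`),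
`𝐅_Q[ρ₁⊗ρ₂] = 𝐅_Q[ρ₁,ĥ^{(1)}] + 𝐅_Q[ρ₂,ĥ^{(2)}]` — an identity valid for all `S^{(i)}_k` (the cross terms vanish by
`Tr ∂ρ_i = 0`). [cite: GessnerPezzeSmerzi2018, Supplement §1.2.2 («`𝐅_Q[ρ^{(1)}⊗⋯⊗ρ^{(N)}, Σ_iĥ^{(i)}] = Σ_i𝐅_Q[ρ^{(i)},ĥ^{(i)}]`»)] -/
theorem qfim_kronecker {ρ₁ : Matrix m m ℂ} {ρ₂ : Matrix k k ℂ} (hρ₁ : ρ₁.trace = 1) (hρ₂ : ρ₂.trace = 1)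
    {h₁ S₁ : ι → Matrix m m ℂ} {h₂ S₂ : ι → Matrix k k ℂ} {F F₁ F₂ : Matrix ι ι ℝ}
    (hF₁ : ∀ a b, F₁ a b = 2 * (S₁ a * (Complex.I • (ρ₁ * h₁ b - h₁ b * ρ₁))).trace.re)
    (hF₂ : ∀ a b, F₂ a b = 2 * (S₂ a * (Complex.I • (ρ₂ * h₂ b - h₂ b * ρ₂))).trace.re)
    (hF : ∀ a b, F a b = 2 * ((S₁ a ⊗ₖ (1 : Matrix k k ℂ) + (1 : Matrix m m ℂ) ⊗ₖ S₂ a) *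
      (Complex.I • ((ρ₁ ⊗ₖ ρ₂) * (h₁ b ⊗ₖ (1 : Matrix k k ℂ) + (1 : Matrix m m ℂ) ⊗ₖ h₂ b) -
        (h₁ b ⊗ₖ (1 : Matrix k k ℂ) + (1 : Matrix m m ℂ) ⊗ₖ h₂ b) * (ρ₁ ⊗ₖ ρ₂)))).trace.re) :
    F = F₁ + F₂ := by
  ext a b
  have h := qfi_kronecker hρ₁ hρ₂ (h₁ b) (S₁ a) (h₂ b) (S₂ a)
  rw [re_two_mul, re_two_mul, re_two_mul] at h
  rw [Matrix.add_apply, hF, hF₁, hF₂, h]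

omit [Fintype n] [DecidableEq n] [Fintype ι] in
/-- **Mode-product states have a block-diagonal QFIM (two modes)**: for `ρ₁ ⊗ ρ₂`, a generator `h ⊗ 1` acting on
mode 1 (SLD `S ⊗ 1`) and a generator `1 ⊗ h'` acting on mode 2, the QFIM entry linking them vanishes.
[cite: GessnerPezzeSmerzi2018, Supplement §1.2.2 («Additivity leads to a diagonal Fisher matrix for mode-product states»)] -/
theorem qfim_kronecker_offDiag_eq_zero {ρ₁ : Matrix m m ℂ} {ρ₂ : Matrix k k ℂ} (hρ₁ : ρ₁.trace = 1)
    (hρ₂ : ρ₂.trace = 1) (S : Matrix m m ℂ) (h' : Matrix k k ℂ) :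
    2 * ((S ⊗ₖ (1 : Matrix k k ℂ)) * (Complex.I • ((ρ₁ ⊗ₖ ρ₂) * ((1 : Matrix m m ℂ) ⊗ₖ h') -
      ((1 : Matrix m m ℂ) ⊗ₖ h') * (ρ₁ ⊗ₖ ρ₂)))).trace.re = 0 := by
  have h := qfi_kronecker hρ₁ hρ₂ (0 : Matrix m m ℂ) S h' (0 : Matrix k k ℂ)
  rw [re_two_mul, re_two_mul, re_two_mul] at h
  simp only [zero_kronecker, kronecker_zero, add_zero, zero_add, Matrix.zero_mul, sub_self,
    smul_zero, trace_zero, Complex.zero_re, mul_zero] at h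
  simpa using h

end Kronecker

end Literature.InformationTheory.StateDiscrimination.QFIMCovariance

end
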